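import Summits.MatrixMultiplication.MatrixMultiplication.Theorems.AbelianSTPPCensusFP4CheckForm

/-!
# Rule U11-F4, checker soundness III: propagation rounds, bisection, `checkBoth = true ⇒ ¬ FP4Adm`

Cell mm-stpp (rung F-M1), theory lane (seat mm-stpp-theory, gen 17).  Last of three files proving `FP4.check` sound.  `Adm p e …  x y z` =
the three letter forms of `FP4Adm` for a fixed table `e`; `BIn b x y z` = the box contains the split.  ONE ROUND (`narrow_some`): sum
tightening, then forms B, A (`−z, x → −y`), C (`y, −z → −x`) read through the `negQ`-views, each via `narrowForm_some`; so a box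
containing an admissible split narrows to a box containing it, for any number of rounds (`narrowR_some`).  BISECTION (`certify_sound`): a
contained split lies in one of the two halves (`BIn.split`, `Q4.get_set`); induction on fuel.  The root box contains every admissible split
(`bIn_rootBox`), so `check e … = true` refutes table `e ≤ 1` (`check_sound`) and `checkBoth = true` refutes `FP4Adm (4p)` for every shape
list with the given totals, maxima and letter lower bounds (`not_fp4Adm_of_checkBoth`).  With `FP4.fp4Sound` (`AbelianSTPPCensusFP4Sound`)
a `true` checker run means: no STPP family with these shapes in any abelian group of that order (first kill: `…FP4Wall604.lean`).
WHAT THIS IS NOT: no census number, no `ω` statement.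
-/

set_option linter.dupNamespace false -- `MatrixMultiplication.MatrixMultiplication` (summit = problem, D-0017)
set_option autoImplicit false

namespace Summit.MatrixMultiplication.MatrixMultiplication.Theorems

open Finset

namespace FP4

section CheckRun

/-! #### The three forms on a box: `narrow`, `narrowR` -/

/-- A box CONTAINS the split `(x, y, z)`. [original] -/
def BIn (b : Box) (x y z : Q4) : Prop := VIn b.xl b.xh x ∧ VIn b.yl b.yh y ∧ VIn b.zl b.zh z

/-- The three letter forms for a fixed table `e` (the body of `FP4Adm`). [original] -/
def Adm (p e X Y Z ca cb cc ma mb mc : ℕ) (x y z : Q4) : Prop :=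
  FormOK p e cb mb X Y Z x y z ∧ FormOK p e ca ma Z X Y (z.neg e) x (y.neg e) ∧ FormOK p e cc mc Y Z X y (z.neg e) (x.neg e)

/-- Un-negating a view: bounds for `−v` in `[−lo, hi']` are bounds for `v` in `[lo, −hi']`. [bookkeeping] -/
theorem VIn.unneg {lo hi' v : Q4} {e : ℕ} (he : e ≤ 1) (h : VIn (lo.neg e) hi' (v.neg e)) : VIn lo (hi'.neg e) v := by
  refine VIn.of_get fun g hg => ?_
  have hn := negQ_lt he hg
  have h1 := h.get (negQ e g)
  rw [Q4.get_neg e lo hn, Q4.get_neg e v hn, negQ_negQ he hg] at h1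
  rw [Q4.get_neg e hi' hg]
  exact h1

/-- **One propagation round is sound**: a box containing an admissible split narrows to a box containing it. [original] -/
theorem narrow_some {p e X Y Z ca cb cc ma mb mc : ℕ} (menu : List ℕ) {x y z : Q4} {b : Box} (he : e ≤ 1)
    (hadm : Adm p e X Y Z ca cb cc ma mb mc x y z) (hin : BIn b x y z) :
    ∃ b' : Box, narrow p e X Y Z ca cb cc ma mb mc menu b = some b' ∧ BIn b' x y z := by
  obtain ⟨hB, hA, hC⟩ := hadm
  obtain ⟨hx, hy, hz⟩ := hin
  have hxs : x.sum = X := hB.1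
  have hys : y.sum = Y := hB.2.1
  have hzs : z.sum = Z := hB.2.2.1
  have hx1 := hx.tight hxs; have hy1 := hy.tight hys; have hz1 := hz.tight hzs
  unfold narrow
  rw [seqBox_eq]
  dsimp only
  rw [okVec_of_VIn hx1 hxs, okVec_of_VIn hy1 hys, okVec_of_VIn hz1 hzs]
  simp only [Bool.and_self, Bool.not_true, Bool.false_eq_true, if_false]
  -- form B
  obtain ⟨zh1, eB, hz2⟩ := narrowForm_some menu he hB hx1 hy1 hz1
  rw [eB]
  dsimp only
  -- form A (summands `−z`, `x`; target `−y`)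
  obtain ⟨yhn, eA, hy2⟩ := narrowForm_some menu he hA (hz2.neg e) hx1 (hy1.neg e)
  rw [eA]
  dsimp only
  rw [seqQ_eq]
  have hy3 : VIn (tightLo Y b.yl b.yh) (yhn.neg e) y := VIn.unneg he hy2
  -- form C (summands `y`, `−z`; target `−x`)
  obtain ⟨xhn, eC, hx2⟩ := narrowForm_some menu he hC hy3 (hz2.neg e) (hx1.neg e)
  rw [eC]
  dsimp only
  rw [seqQ_eq]
  have hx3 : VIn (tightLo X b.xl b.xh) (xhn.neg e) x := VIn.unneg he hx2
  rw [okVec_of_VIn hx3 hxs, okVec_of_VIn hy3 hys, okVec_of_VIn hz2 hzs]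
  simp only [Bool.and_self, if_true]
  exact ⟨_, rfl, hx3, hy3, hz2⟩

/-- `R` rounds are sound. [original] -/
theorem narrowR_some {p e X Y Z ca cb cc ma mb mc : ℕ} (menu : List ℕ) {x y z : Q4} (he : e ≤ 1)
    (hadm : Adm p e X Y Z ca cb cc ma mb mc x y z) :
    ∀ (R : ℕ) (b : Box), BIn b x y z → ∃ b' : Box, narrowR p e X Y Z ca cb cc ma mb mc menu R b = some b' ∧ BIn b' x y z := by
  intro R
  induction R with
  | zero => intro b hin; exact ⟨b, rfl, hin⟩
  | succ r ih =>
    intro b hin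
    obtain ⟨b1, e1, h1⟩ := narrow_some menu he hadm hin
    unfold narrowR
    rw [e1]
    exact ih b1 h1

/-! #### Bisection -/

/-- `argWidest < 4`. [bookkeeping] -/
theorem Q4.argWidest_lt (lo hi : Q4) : Q4.argWidest lo hi < 4 := by
  unfold Q4.argWidest; dsimp only; split_ifs <;> omega

/-- Reading an updated vector. [bookkeeping] -/
theorem Q4.get_set (q : Q4) {i : ℕ} (hi : i < 4) (val : ℕ) {j : ℕ} (hj : j < 4) :
    (q.set i val).get j = if j = i then val else q.get j := by
  cases q
  match i, hi, j, hj with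
  | 0, _, 0, _ => rfl
  | 0, _, 1, _ => rfl
  | 0, _, 2, _ => rfl
  | 0, _, 3, _ => rfl
  | 1, _, 0, _ => rfl
  | 1, _, 1, _ => rfl
  | 1, _, 2, _ => rfl
  | 1, _, 3, _ => rfl
  | 2, _, 0, _ => rfl
  | 2, _, 1, _ => rfl
  | 2, _, 2, _ => rfl
  | 2, _, 3, _ => rfl
  | 3, _, 0, _ => rfl
  | 3, _, 1, _ => rfl
  | 3, _, 2, _ => rfl
  | 3, _, 3, _ => rfl

/-- Cutting one coordinate at `mid` keeps every contained vector in one of the two halves. [original] -/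
theorem VIn.split {lo hi v : Q4} (h : VIn lo hi v) {i : ℕ} (hi4 : i < 4) :
    VIn lo (hi.set i ((lo.get i + hi.get i) / 2)) v ∨ VIn (lo.set i ((lo.get i + hi.get i) / 2 + 1)) hi v := by
  by_cases hle : v.get i ≤ (lo.get i + hi.get i) / 2
  · left
    refine VIn.of_get fun g hg => ?_
    rw [Q4.get_set hi hi4 _ hg]
    split_ifs with hgi
    · subst hgi; exact ⟨(h.get g).1, hle⟩
    · exact h.get g
  · right
    refine VIn.of_get fun g hg => ?_
    rw [Q4.get_set lo hi4 _ hg]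
    split_ifs with hgi
    · subst hgi; exact ⟨by omega, (h.get g).2⟩
    · exact h.get g

/-- A contained split lies in one of the two halves of `split`. [original] -/
theorem BIn.split {b : Box} {x y z : Q4} (h : BIn b x y z) : BIn (split b).1 x y z ∨ BIn (split b).2 x y z := by
  obtain ⟨hx, hy, hz⟩ := h
  unfold FP4.split
  dsimp only
  split_ifs with h1 h2
  · rcases hx.split (Q4.argWidest_lt b.xl b.xh) with h | h
    · exact Or.inl ⟨h, hy, hz⟩
    · exact Or.inr ⟨h, hy, hz⟩
  · rcases hy.split (Q4.argWidest_lt b.yl b.yh) with h | h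
    · exact Or.inl ⟨hx, h, hz⟩
    · exact Or.inr ⟨hx, h, hz⟩
  · rcases hz.split (Q4.argWidest_lt b.zl b.zh) with h | h
    · exact Or.inl ⟨hx, hy, h⟩
    · exact Or.inr ⟨hx, hy, h⟩

/-- **The bisection is sound**: a certified box contains no admissible split. [original] -/
theorem certify_sound {p e X Y Z ca cb cc ma mb mc : ℕ} (menu : List ℕ) (R : ℕ) {x y z : Q4} (he : e ≤ 1)
    (hadm : Adm p e X Y Z ca cb cc ma mb mc x y z) :
    ∀ (fuel : ℕ) (b : Box), certify p e X Y Z ca cb cc ma mb mc menu R fuel b = true → ¬ BIn b x y z := by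
  intro fuel
  induction fuel with
  | zero =>
    intro b hc hin
    obtain ⟨b', e', -⟩ := narrowR_some menu he hadm R b hin
    unfold certify at hc
    rw [e'] at hc
    exact Bool.false_ne_true hc
  | succ n ih =>
    intro b hc hin
    obtain ⟨b', e', hin'⟩ := narrowR_some menu he hadm R b hin
    unfold certify at hc
    rw [e'] at hc
    dsimp only at hc
    rw [seqBox_eq, seqBox_eq] at hc
    simp only [Bool.and_eq_true] at hc
    obtain ⟨-, hc1, hc2⟩ := hc
    rcases hin'.split with h | h
    · exact ih _ hc1 h
    · exact ih _ hc2 h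


/-! #### Assembling a certificate from certified sub-boxes (for chunked kernel evaluation) -/

/-- ONE BISECTION STEP, for gluing separately certified halves: if `R` rounds narrow `b` to `b'`, `b'` is not a point, `b'` splits into
`(b1, b2)` and both halves are certified with fuel `fuel`, then `b` is certified with fuel `fuel + 1`. [bookkeeping] -/
theorem certify_step {p e X Y Z ca cb cc ma mb mc : ℕ} {menu : List ℕ} {R fuel : ℕ} {b b' b1 b2 : Box}
    (hn : narrowR p e X Y Z ca cb cc ma mb mc menu R b = some b') (hp : isPoint b' = false) (hs : split b' = (b1, b2))
    (h1 : certify p e X Y Z ca cb cc ma mb mc menu R fuel b1 = true) (h2 : certify p e X Y Z ca cb cc ma mb mc menu R fuel b2 = true) :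
    certify p e X Y Z ca cb cc ma mb mc menu R (fuel + 1) b = true := by
  unfold certify
  rw [hn]
  dsimp only
  rw [seqBox_eq, seqBox_eq, hs, hp, h1, h2]
  rfl

/-- The checker for one table is the certificate of the root box. [bookkeeping] -/
theorem check_eq_certify (e p X Y Z ca cb cc ma mb mc : ℕ) (menu : List ℕ) (R fuel : ℕ) :
    check e p X Y Z ca cb cc ma mb mc menu R fuel = certify p e X Y Z ca cb cc ma mb mc menu R fuel (rootBox p X Y Z) := rfl

/-- The root box contains every admissible split. [bookkeeping] -/
theorem bIn_rootBox {p e X Y Z ca cb cc ma mb mc : ℕ} {x y z : Q4} (hadm : Adm p e X Y Z ca cb cc ma mb mc x y z) :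
    BIn (rootBox p X Y Z) x y z := by
  obtain ⟨⟨hxs, hys, hzs, a0, a1, a2, a3, c0, c1, c2, c3, t0, t1, t2, t3⟩, -, -⟩ := hadm
  have sx := Q4.get_le_sum x; have sy := Q4.get_le_sum y; have sz := Q4.get_le_sum z
  rw [hxs] at sx; rw [hys] at sy; rw [hzs] at sz
  refine ⟨VIn.of_get fun g hg => ?_, VIn.of_get fun g hg => ?_, VIn.of_get fun g hg => ?_⟩
  · match g, hg with
    | 0, _ => exact ⟨Nat.zero_le _, le_min (sx 0) a0⟩
    | 1, _ => exact ⟨Nat.zero_le _, le_min (sx 1) a1⟩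
    | 2, _ => exact ⟨Nat.zero_le _, le_min (sx 2) a2⟩
    | 3, _ => exact ⟨Nat.zero_le _, le_min (sx 3) a3⟩
  · match g, hg with
    | 0, _ => exact ⟨Nat.zero_le _, le_min (sy 0) c0⟩
    | 1, _ => exact ⟨Nat.zero_le _, le_min (sy 1) c1⟩
    | 2, _ => exact ⟨Nat.zero_le _, le_min (sy 2) c2⟩
    | 3, _ => exact ⟨Nat.zero_le _, le_min (sy 3) c3⟩
  · match g, hg with
    | 0, _ => exact ⟨Nat.zero_le _, le_min (sz 0) t0.1⟩
    | 1, _ => exact ⟨Nat.zero_le _, le_min (sz 1) t1.1⟩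
    | 2, _ => exact ⟨Nat.zero_le _, le_min (sz 2) t2.1⟩
    | 3, _ => exact ⟨Nat.zero_le _, le_min (sz 3) t3.1⟩

/-- **The checker for one table is sound**: `check e … = true` refutes every admissible split for the table `e ≤ 1`. [original] -/
theorem check_sound {e p X Y Z ca cb cc ma mb mc : ℕ} {menu : List ℕ} {R fuel : ℕ} (he : e ≤ 1)
    (hc : check e p X Y Z ca cb cc ma mb mc menu R fuel = true) (x y z : Q4) : ¬ Adm p e X Y Z ca cb cc ma mb mc x y z :=
  fun hadm => certify_sound menu R he hadm fuel _ hc (bIn_rootBox hadm)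

variable {N : ℕ}

/-- **`checkBoth = true` refutes `FP4Adm (4p)`** for every shape list with the given totals `(X, Y, Z) = (P_AB, P_BC, P_CA)`, letter maxima
`(ca, cb, cc)` and letter lower bounds `ma ≤ a_i`, `mb ≤ b_i`, `mc ≤ c_i` (`p` an odd prime, `M = 4p`). [original] -/
theorem not_fp4Adm_of_checkBoth {M p X Y Z ca cb cc ma mb mc : ℕ} {a b c : Fin N → ℕ} {menu : List ℕ} {R fuel : ℕ}
    (hM : M = 4 * p) (hp : p.Prime) (hp3 : 3 ≤ p) (hX : pAB a b c = X) (hY : pBC a b c = Y) (hZ : pCA a b c = Z)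
    (hca : univ.sup a = ca) (hcb : univ.sup b = cb) (hcc : univ.sup c = cc) (ha : ∀ i, ma ≤ a i) (hb : ∀ i, mb ≤ b i) (hc : ∀ i, mc ≤ c i)
    (hchk : checkBoth p X Y Z ca cb cc ma mb mc menu R fuel = true) :
    ¬ FP4Adm M a b c := by
  intro h
  obtain ⟨e, he, x, y, z, hB, hA, hC⟩ := h p hM hp hp3 ma mb mc ha hb hc
  subst hX hY hZ hca hcb hcc
  unfold checkBoth at hchk
  rw [Bool.and_eq_true] at hchk
  rcases Nat.le_one_iff_eq_zero_or_eq_one.mp he with rfl | rfl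
  · exact check_sound (by omega) hchk.1 x y z ⟨hB, hA, hC⟩
  · exact check_sound (by omega) hchk.2 x y z ⟨hB, hA, hC⟩

end CheckRun

end FP4

end Summit.MatrixMultiplication.MatrixMultiplication.Theorems
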